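import Mathlib

/-!
# `Balaban1983to89.T4Genealogy` — LEMMA Y's COUNTING BINDERS ON A GENEALOGY LEDGER (cell `pub-balaban`, node U5)
(record `t4/T4-EST-U5E-rem.md` §4 (unit `b2b-balaban-pv25`), consumer `…T4BankAgeYoung.lifetime_lt` BY SHAPE;
journal CLAIM T4-U5.E-REM-GENEALOGY-K* 2026-08-19T04:44:38Z, unit `b2b-balaban-pv25` gen 7 — NEW leaf module,
imports `Mathlib` ONLY and modifies nothing; `…T4BankAgeYoung` / `…T4SizeLedger` / `…T4EpochSize` /
`…T4Enlargement` (this lineage) are deliberately NOT imported: their binders are matched literally, by shape)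

HONEST FRAMING (cell `pub-balaban`, T4-DAG PAGE 1).  The cell's T4 target is the existence AND uniqueness of the
continuum limit of Bałaban's unit-scale averaged loop expectations on a finite torus — strictly beyond ultraviolet
stability ([Balaban1989LargeFieldII] Thm 1 p. 355); it is NOT the Yang–Mills mass gap and NOT the Clay problem.  This
module is FINITE BOOKKEEPING AND REAL ARITHMETIC ONLY [folklore].  NOTHING of [Balaban1989LargeFieldII],
[Balaban1988RG2Cluster] or [Balaban1987RG1] is asserted here: there is no quotation, no page claim and no `[cite:]` tag
in this file; the two SIZE INPUTS of the ledger (per foundation, per event) and every count that print would have to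
supply enter as BINDERS, named below.

WHAT THIS MODULE ADDS (all kernel-checked).  `…T4BankAgeYoung.lifetime_lt` (Lemma Y: small bank ⇒ recent creation)
is stated over abstract DATA `Ψ f v σ : ℕ → ℝ` of one sub-history with the binders
`hf hv hΨ0 hfound hstep hD hV hσ` (and the profile / horizon binders `hint hhalf hlen hR`, not touched here).
`…T4SizeLedger` discharged the SHAPES of `hfound` / `hstep` for ONE foundation / ONE event on the cell's size model,
leaving «the COUNTING binders hD, hV of lifetime_lt (numbers of events, births and vertices along a sub-history), which
are bookkeeping over histories» open.  Here the sub-history itself is modelled and the data are DEFINED from it: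
* §1 `Ledger κ` — the GENEALOGY LEDGER (raw data) of one sub-history: `E` events; `founded e` = the lineages founded
  during epoch `e` (epoch `0` = the creation epoch, `base₀ ∈ founded 0`); event `e+1` (closing epoch `e`, `e < E`)
  CONSUMES the old parts `consumed e` and PRODUCES the lineage `product e`; every lineage `ℓ` carries ONE size
  `size ℓ ≥ 0` (its size when founded / produced = its epoch-start size) and, if founded, a founding birth mass
  `fmass ℓ ≥ 1` (`Σ (b+1)` over its founding regions); event `e+1` carries the new-part mass `gmass e ≥ 0` (`Σ (b+1)`
  over the regions born INTO the merger).  A renewal is an event with one consumed part and `gmass = 0`; nothing forces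
  distinct names, disjointness or `#alive E = 1` — the inequalities below hold without them.
* §2 the DATA `f v σ` of `lifetime_lt`, zero-padded beyond the last event: `f 0 = Σ_{founded 0} fmass`,
  `f (e+1) = gmass e + Σ_{founded (e+1)} fmass` (`e < E`, else `0`), `v (e+1) = #consumed e` (`e < E`, else `0`),
  `v 0 = 0`, `σ 0 = size base₀`, `σ (e+1) = size (product e)` (`e < E`, else `0`), the total booked birth mass
  `Dtot = Σ_{i ≤ E} f i`; padding (`sum_f_eq_Dtot`, `sum_v_eq`), `hD : Σ_{i≤m} f i ≤ D` from `Dtot ≤ D`, and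
  `events_le_bank` — the one-line reason for `E ≤ m` (every event banks at least one credit).
* §3 the ALIVE SET `alive` (`alive 0 = founded 0`, `alive (e+1) = insert (product e) (alive e \ consumed e) ∪
  founded (e+1)`), WELL-FORMEDNESS `WF` (= the sentences of §1: `base₀ ∈ founded 0`, `consumed e ⊆ alive e`,
  `0 ≤ size`, `1 ≤ fmass` on founded lineages, `0 ≤ gmass`) and the POTENTIAL `Ψ i = Σ_{ℓ ∈ alive (min i E)} (size ℓ + 1)`.
* §4 the binders PROVED on the ledger from the two SIZE INPUTS — per foundation `size ℓ + 1 ≤ a·fmass ℓ`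
  (`…T4SizeLedger.foundation_hfound`'s shape, `a = 2·14^d`; `a = 4·14^d` with `…T4Enlargement`'s model constant) and per
  event `size (product e) + 2 ≤ C·Σ_{consumed e}(size+1) + 2·#(consumed e) + a·gmass e` (`…T4SizeLedger.event_size_le`'s
  shape): `f_nonneg`, `v_nonneg`, `Ψ_nonneg` (hf hv hΨ0); `hfound : Ψ 0 ≤ a·f 0`; `hstep : Ψ (i+1) ≤ C·Ψ i + (a·f (i+1)
  + 2·d·v (i+1))` for `1 ≤ C`, `1 ≤ d` (the potential step of record §4 (2c), re-derived on the ledger: the surviving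
  lineages keep their terms, the product's term is paid by the event input, the newly founded ones by the foundation
  input; the model's join cost `2·#consumed − 1 ≤ 2d·#consumed`); the LINEAGE COUNT `Σ_{e<E} #consumed e + #alive E ≤
  Σ_{e≤E} #founded e + E` (`count_le`: each event removes `#consumed e` lineages and adds one, foundations add the rest)
  whence `sum_v_add_one_le : Σ_{i≤m} v i + 1 ≤ Dtot + E` and `hV : Σ_{i≤m} v i ≤ 2·m + D` from `E ≤ m`, `Dtot ≤ D`
  (every founded lineage books mass `≥ 1`, one lineage is alive at the end); `hσ : ∀ i ≤ m, ∃ t ≤ m, σ i ≤ C·Ψ t`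
  (the base of epoch `i` is alive in epoch `i`: `t = i`).
  `lifetime_binders` packages the eight in the literal order and shapes of `lifetime_lt` (general `a`);
  `lifetime_binders_two` / `lifetime_binders_four` are the instances `a = 2·14^d` / `a = 4·14^d` (`lifetime_lt` /
  `lifetime_lt_four` of `…T4BankAgeYoung` v1.1).
* §5 NON-VACUITY: a two-founder / one-merger ledger on `ℕ` satisfying `WF` and both size inputs with `a = 2`, `C = 1`,
  on which `Ψ 0 = 4`, `Ψ 1 = 6` (the step bound is the genuine inequality `6 ≤ 4 + 4`).

WHAT REMAINS A BINDER / A READING (named, not hidden).  (i) The S-SIDE CREDITS: that print's κ-induction banks `c_e·p̄₀`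
per event and `c_s·p̄₀²·(b+1)` per born region, i.e. the bank inequality `hb` of `lifetime_lt` together with `E ≤ m` and
`Dtot ≤ D` (record §3 S1 [analysis]; here they are the hypotheses `hm`, `hDD` of `lifetime_binders`).  (ii) The two SIZE
INPUTS `hfnd`, `hev` — discharged ON THE CELL'S SIZE MODEL by `…T4SizeLedger.foundation_hfound` / `event_size_le` with
`…T4EpochSize.epochSize_le_modelC` ((2a), old parts) and `…T4Enlargement.hnew_collar_two/three` ((γ), new parts, model
constant `4·14^d`) under the print ↔ model identifications recorded in `t4/T4-EST-U5E-rem-ident.md` (unit b01) — those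
modules are the place where print's `d′_j` meets the model; this file never mentions a size model.  (iii) The profile
and horizon binders `hint hhalf hlen hR` of `lifetime_lt` (halving / integrality: `…T4EpochSize`; the printed horizon
«K ≤ n₀ − j + R_j»: a binder).  (iv) That a printed sub-history IS a well-formed ledger in the sense of §1/§3 (one size per
lineage, consumed parts alive, founding masses ≥ 1 because every born region is credited with `b + 1 ≥ 1`) is the
READING this file makes explicit; print sums no histories.  Cell census: discharged COUNTING binders of a kernel
skeleton on the cell's MODEL, NOT summit progress; NOT continuum, NOT Clay.
-/

namespace Literature.MathematicalPhysics.QuantumFieldTheory.Balaban1983to89.T4Genealogy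

open Finset

/-! ## §1 The genealogy ledger of one sub-history -/

/-- GENEALOGY LEDGER (raw data) of one sub-history: `E` events; `founded e` = lineages founded during epoch `e`;
event `e+1` (`e < E`) consumes the old parts `consumed e` and produces the lineage `product e`; `base₀` = the lineage
founded at the creation step; `size ℓ` = the (epoch-start) size of lineage `ℓ`; `fmass ℓ` = its founding birth mass;
`gmass e` = the new-part birth mass of event `e+1`.  Data beyond index `E` are never read (zero-padding in §2). [folklore] -/
structure Ledger (κ : Type*) where
  /-- number of events of the sub-history [folklore] -/
  E : ℕ
  /-- lineages founded during epoch `e` (`e ≤ E`) [folklore] -/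
  founded : ℕ → Finset κ
  /-- old parts consumed by event `e+1` (`e < E`) [folklore] -/
  consumed : ℕ → Finset κ
  /-- the lineage produced by event `e+1` (`e < E`) [folklore] -/
  product : ℕ → κ
  /-- the lineage founded at the creation step [folklore] -/
  base₀ : κ
  /-- size of a lineage when founded / produced (its epoch-start size) [folklore] -/
  size : κ → ℝ
  /-- founding birth mass of a lineage (`Σ (b+1)` over its founding regions) [folklore] -/
  fmass : κ → ℝ
  /-- new-part birth mass of event `e+1` (`Σ (b+1)` over the regions born into the merger) [folklore] -/
  gmass : ℕ → ℝ

namespace Ledger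

variable {κ : Type*}

/-! ## §2 The data `f v σ` of `lifetime_lt`, zero-padded beyond the last event -/

section Data

variable (L : Ledger κ)

/-- Birth mass booked at index `i`: the founders' masses of epoch `0`; at index `e+1 ≤ E` the new-part mass of event
`e+1` plus the masses of the lineages founded during epoch `e+1`; `0` beyond the last event. [folklore] -/
def f : ℕ → ℝ
  | 0 => ∑ ℓ ∈ L.founded 0, L.fmass ℓ
  | e + 1 => if e < L.E then L.gmass e + ∑ ℓ ∈ L.founded (e + 1), L.fmass ℓ else 0

/-- Vertices (consumed old parts) booked at index `i`: `#consumed e` at index `e+1 ≤ E`, else `0`. [folklore] -/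
def v : ℕ → ℝ
  | 0 => 0
  | e + 1 => if e < L.E then ((L.consumed e).card : ℝ) else 0

/-- The epoch-start size of the base lineage of epoch `i`: the creation lineage for `i = 0`, the product of event `i`
for `1 ≤ i ≤ E`, `0` beyond the last event. [folklore] -/
def σ : ℕ → ℝ
  | 0 => L.size L.base₀
  | e + 1 => if e < L.E then L.size (L.product e) else 0

/-- Total booked birth mass of the sub-history. [folklore] -/
def Dtot : ℝ := ∑ i ∈ range (L.E + 1), L.f i

/-- `f 0` is the founders' birth mass of epoch `0`. [folklore] -/
@[simp] theorem f_zero : L.f 0 = ∑ ℓ ∈ L.founded 0, L.fmass ℓ := rfl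

/-- `f (e+1)` for an event index `e < E`. [folklore] -/
theorem f_succ_of_lt {e : ℕ} (he : e < L.E) :
    L.f (e + 1) = L.gmass e + ∑ ℓ ∈ L.founded (e + 1), L.fmass ℓ := by
  simp [f, he]

/-- `f` vanishes beyond the last event. [folklore] -/
theorem f_succ_of_le {e : ℕ} (he : L.E ≤ e) : L.f (e + 1) = 0 := by
  simp [f, Nat.not_lt.mpr he]

/-- No vertices are booked at index `0`. [folklore] -/
@[simp] theorem v_zero : L.v 0 = 0 := rfl

/-- `v (e+1) = #consumed e` for an event index `e < E`. [folklore] -/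
theorem v_succ_of_lt {e : ℕ} (he : e < L.E) : L.v (e + 1) = ((L.consumed e).card : ℝ) := by
  simp [v, he]

/-- `v` vanishes beyond the last event. [folklore] -/
theorem v_succ_of_le {e : ℕ} (he : L.E ≤ e) : L.v (e + 1) = 0 := by
  simp [v, Nat.not_lt.mpr he]

/-- `σ 0` is the size of the creation lineage. [folklore] -/
@[simp] theorem σ_zero : L.σ 0 = L.size L.base₀ := rfl

/-- `σ (e+1)` is the size of the product of event `e+1` (`e < E`). [folklore] -/
theorem σ_succ_of_lt {e : ℕ} (he : e < L.E) : L.σ (e + 1) = L.size (L.product e) := by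
  simp [σ, he]

/-- `σ` vanishes beyond the last event. [folklore] -/
theorem σ_succ_of_le {e : ℕ} (he : L.E ≤ e) : L.σ (e + 1) = 0 := by
  simp [σ, Nat.not_lt.mpr he]

/-- `hv`: vertex counts are non-negative. [folklore] -/
theorem v_nonneg : ∀ i, 0 ≤ L.v i
  | 0 => le_rfl
  | e + 1 => by
    by_cases he : e < L.E
    · rw [L.v_succ_of_lt he]; exact Nat.cast_nonneg _
    · rw [L.v_succ_of_le (Nat.not_lt.mp he)]

/-- Zero-padding: a sequence vanishing beyond index `E` has the same partial sums from `E` on. [folklore] -/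
theorem sum_range_eq_of_vanish {g : ℕ → ℝ} {E : ℕ} (hg : ∀ i, E < i → g i = 0) :
    ∀ m, E ≤ m → ∑ i ∈ range (m + 1), g i = ∑ i ∈ range (E + 1), g i := by
  intro m hm
  induction m, hm using Nat.le_induction with
  | base => rfl
  | succ m hm ih => rw [sum_range_succ, ih, hg (m + 1) (Nat.lt_succ_of_le hm), add_zero]

/-- Padding: the booked birth mass up to any index `m ≥ E` is the total `Dtot`. [folklore] -/
theorem sum_f_eq_Dtot {m : ℕ} (hm : L.E ≤ m) : ∑ i ∈ range (m + 1), L.f i = L.Dtot := by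
  refine sum_range_eq_of_vanish (fun i hi => ?_) m hm
  obtain ⟨e, rfl⟩ := Nat.exists_eq_succ_of_ne_zero (Nat.pos_iff_ne_zero.mp (lt_of_le_of_lt (Nat.zero_le _) hi))
  exact L.f_succ_of_le (Nat.lt_succ_iff.mp hi)

/-- `hD`: the booked birth mass up to index `m ≥ E` is at most any bound for the total. [folklore] -/
theorem hD {m : ℕ} (hm : L.E ≤ m) {D : ℝ} (hD : L.Dtot ≤ D) : ∑ i ∈ range (m + 1), L.f i ≤ D := by
  rw [L.sum_f_eq_Dtot hm]; exact hD

/-- Padding: the vertex sum up to any index `m ≥ E` is the number of consumed parts. [folklore] -/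
theorem sum_v_eq {m : ℕ} (hm : L.E ≤ m) :
    ∑ i ∈ range (m + 1), L.v i = ((∑ e ∈ range L.E, (L.consumed e).card : ℕ) : ℝ) := by
  have hvan : ∀ i, L.E < i → L.v i = 0 := by
    intro i hi
    obtain ⟨e, rfl⟩ := Nat.exists_eq_succ_of_ne_zero (Nat.pos_iff_ne_zero.mp (lt_of_le_of_lt (Nat.zero_le _) hi))
    exact L.v_succ_of_le (Nat.lt_succ_iff.mp hi)
  rw [sum_range_eq_of_vanish hvan m hm, sum_range_succ', v_zero, add_zero, Nat.cast_sum]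
  exact sum_congr rfl fun e he => L.v_succ_of_lt (mem_range.mp he)

/-- The one-line reason for `E ≤ m`: if every event banks at least one credit, the events are at most the bank. [folklore] -/
theorem events_le_bank {credit : ℕ → ℕ} (h : ∀ e, e < L.E → 1 ≤ credit e) :
    L.E ≤ ∑ e ∈ range L.E, credit e := by
  calc L.E = ∑ e ∈ range L.E, 1 := by simp
    _ ≤ ∑ e ∈ range L.E, credit e := sum_le_sum fun e he => h e (mem_range.mp he)

end Data

/-! ## §3 The alive set, well-formedness and the potential `Ψ` -/

section Alive

variable [DecidableEq κ] (L : Ledger κ)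

/-- The set of lineages alive in epoch `e`: the founders of epoch `0`; after event `e+1` the product replaces the
consumed parts and the lineages founded during epoch `e+1` join. [folklore] -/
def alive : ℕ → Finset κ
  | 0 => L.founded 0
  | e + 1 => insert (L.product e) (alive e \ L.consumed e) ∪ L.founded (e + 1)

/-- WELL-FORMEDNESS of a ledger: the creation lineage is a founder of epoch `0`; consumed parts are alive; sizes are
non-negative; founding masses are `≥ 1`; new-part masses are non-negative. [folklore] -/
structure WF : Prop where
  /-- the creation lineage is founded in epoch `0` [folklore] -/
  base₀_mem : L.base₀ ∈ L.founded 0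
  /-- an event consumes only alive lineages [folklore] -/
  consumed_sub : ∀ e, e < L.E → L.consumed e ⊆ L.alive e
  /-- sizes are non-negative [folklore] -/
  size_nonneg : ∀ ℓ, 0 ≤ L.size ℓ
  /-- every founded lineage books birth mass at least one [folklore] -/
  one_le_fmass : ∀ e ℓ, ℓ ∈ L.founded e → 1 ≤ L.fmass ℓ
  /-- new-part masses are non-negative [folklore] -/
  gmass_nonneg : ∀ e, 0 ≤ L.gmass e

/-- The lineages alive in epoch `0` are the founders of epoch `0`. [folklore] -/
@[simp] theorem alive_zero : L.alive 0 = L.founded 0 := rfl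

/-- The event rule for the alive set (definitional). [folklore] -/
theorem alive_succ (e : ℕ) :
    L.alive (e + 1) = insert (L.product e) (L.alive e \ L.consumed e) ∪ L.founded (e + 1) := rfl

/-- The product of event `e+1` is alive in epoch `e+1`. [folklore] -/
theorem product_mem_alive (e : ℕ) : L.product e ∈ L.alive (e + 1) := by
  rw [alive_succ]
  exact mem_union_left _ (mem_insert_self _ _)

/-- Lineages founded during epoch `e` are alive in epoch `e`. [folklore] -/
theorem founded_subset_alive : ∀ e, L.founded e ⊆ L.alive e
  | 0 => by simp
  | e + 1 => by rw [alive_succ]; exact subset_union_right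

/-- Some lineage is alive in every epoch (the creation lineage, then the products). [folklore] -/
theorem alive_nonempty (hW : L.WF) : ∀ e, (L.alive e).Nonempty
  | 0 => ⟨L.base₀, by simpa using hW.base₀_mem⟩
  | e + 1 => ⟨L.product e, L.product_mem_alive e⟩

/-- The potential of epoch `i`: `Σ_{alive} (size + 1)`, frozen after the last event. [folklore] -/
def Ψ (i : ℕ) : ℝ := ∑ ℓ ∈ L.alive (min i L.E), (L.size ℓ + 1)

/-- `Ψ i` for `i ≤ E` is the sum over the lineages alive in epoch `i`. [folklore] -/
theorem Ψ_of_le {i : ℕ} (hi : i ≤ L.E) : L.Ψ i = ∑ ℓ ∈ L.alive i, (L.size ℓ + 1) := by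
  simp [Ψ, Nat.min_eq_left hi]

/-- `Ψ` is frozen from the last event on. [folklore] -/
theorem Ψ_of_ge {i : ℕ} (hi : L.E ≤ i) : L.Ψ i = ∑ ℓ ∈ L.alive L.E, (L.size ℓ + 1) := by
  simp [Ψ, Nat.min_eq_right hi]

end Alive

/-! ## §4 The binders of `lifetime_lt`, proved on the ledger -/

section Binders

variable [DecidableEq κ] {L : Ledger κ}

/-- `hf`: booked birth masses are non-negative. [folklore] -/
theorem f_nonneg (hW : L.WF) : ∀ i, 0 ≤ L.f i
  | 0 => by
    rw [f_zero]
    exact sum_nonneg fun ℓ hℓ => le_trans zero_le_one (hW.one_le_fmass 0 ℓ hℓ)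
  | e + 1 => by
    by_cases he : e < L.E
    · rw [L.f_succ_of_lt he]
      exact add_nonneg (hW.gmass_nonneg e)
        (sum_nonneg fun ℓ hℓ => le_trans zero_le_one (hW.one_le_fmass (e + 1) ℓ hℓ))
    · rw [L.f_succ_of_le (Nat.not_lt.mp he)]

/-- The terms of the potential are non-negative (indeed `≥ 1`). [folklore] -/
theorem term_nonneg (hW : L.WF) (ℓ : κ) : 0 ≤ L.size ℓ + 1 := by
  have := hW.size_nonneg ℓ; linarith

/-- `hΨ0` (and more): the potential is non-negative. [folklore] -/
theorem Ψ_nonneg (hW : L.WF) (i : ℕ) : 0 ≤ L.Ψ i :=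
  sum_nonneg fun ℓ _ => term_nonneg hW ℓ

/-- A single alive lineage is bounded by the potential of its epoch. [folklore] -/
theorem size_le_Ψ (hW : L.WF) {i : ℕ} (hi : i ≤ L.E) {ℓ : κ} (hℓ : ℓ ∈ L.alive i) : L.size ℓ ≤ L.Ψ i := by
  rw [L.Ψ_of_le hi]
  have h : L.size ℓ + 1 ≤ ∑ x ∈ L.alive i, (L.size x + 1) :=
    single_le_sum (f := fun ℓ => L.size ℓ + 1) (fun ℓ _ => term_nonneg hW ℓ) hℓ
  linarith

/-- `hfound`: the foundation bound `Ψ 0 ≤ a·f 0` from the per-foundation size input at epoch `0`. [folklore] -/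
theorem hfound {a : ℝ} (hfnd : ∀ ℓ ∈ L.founded 0, L.size ℓ + 1 ≤ a * L.fmass ℓ) : L.Ψ 0 ≤ a * L.f 0 := by
  rw [L.Ψ_of_le (Nat.zero_le _), alive_zero, f_zero, mul_sum]
  exact sum_le_sum fun ℓ hℓ => hfnd ℓ hℓ

/-- Sums of non-negative terms over a union are bounded by the sum of the two sums. [folklore] -/
theorem sum_union_le_of_nonneg {s t : Finset κ} {w : κ → ℝ} (hw : ∀ ℓ, 0 ≤ w ℓ) :
    ∑ ℓ ∈ s ∪ t, w ℓ ≤ ∑ ℓ ∈ s, w ℓ + ∑ ℓ ∈ t, w ℓ := by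
  have h := sum_union_inter (s₁ := s) (s₂ := t) (f := w)
  have h' : 0 ≤ ∑ ℓ ∈ s ∩ t, w ℓ := sum_nonneg fun ℓ _ => hw ℓ
  linarith

/-- THE POTENTIAL STEP across one event (record §4 (2c), re-derived on the ledger): the surviving lineages keep their
terms, the product's term is paid by the per-event size input, the lineages founded during the new epoch by the
per-foundation input; the join cost `2·#consumed − 1` is absorbed in `2d·#consumed` for `d ≥ 1`. [folklore] -/
theorem Ψ_succ_le (hW : L.WF) {a C : ℝ} (hC : 1 ≤ C) {d : ℕ} (hd : 1 ≤ d) {e : ℕ} (he : e < L.E)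
    (hfnd : ∀ ℓ ∈ L.founded (e + 1), L.size ℓ + 1 ≤ a * L.fmass ℓ)
    (hev : L.size (L.product e) + 2 ≤
      C * ∑ ℓ ∈ L.consumed e, (L.size ℓ + 1) + 2 * ((L.consumed e).card : ℝ) + a * L.gmass e) :
    L.Ψ (e + 1) ≤ C * L.Ψ e + (a * L.f (e + 1) + 2 * d * L.v (e + 1)) := by
  set w : κ → ℝ := fun ℓ => L.size ℓ + 1 with hw_def
  have hw : ∀ ℓ, 0 ≤ w ℓ := fun ℓ => term_nonneg hW ℓ
  have hPA : L.consumed e ⊆ L.alive e := hW.consumed_sub e he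
  rw [L.Ψ_of_le he, L.Ψ_of_le he.le, L.f_succ_of_lt he, L.v_succ_of_lt he, alive_succ]
  -- split the alive set of the new epoch
  have h1 : ∑ ℓ ∈ insert (L.product e) (L.alive e \ L.consumed e) ∪ L.founded (e + 1), w ℓ ≤
      ∑ ℓ ∈ insert (L.product e) (L.alive e \ L.consumed e), w ℓ + ∑ ℓ ∈ L.founded (e + 1), w ℓ :=
    sum_union_le_of_nonneg hw
  have h2 : ∑ ℓ ∈ insert (L.product e) (L.alive e \ L.consumed e), w ℓ ≤
      w (L.product e) + ∑ ℓ ∈ L.alive e \ L.consumed e, w ℓ := by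
    rw [insert_eq]
    have h := sum_union_le_of_nonneg (s := {L.product e}) (t := L.alive e \ L.consumed e) hw
    simpa using h
  have h3 : ∑ ℓ ∈ L.alive e \ L.consumed e, w ℓ + ∑ ℓ ∈ L.consumed e, w ℓ = ∑ ℓ ∈ L.alive e, w ℓ :=
    sum_sdiff hPA
  have h4 : ∑ ℓ ∈ L.founded (e + 1), w ℓ ≤ a * ∑ ℓ ∈ L.founded (e + 1), L.fmass ℓ := by
    rw [mul_sum]; exact sum_le_sum fun ℓ hℓ => hfnd ℓ hℓ
  have h5 : ∑ ℓ ∈ L.consumed e, w ℓ ≤ ∑ ℓ ∈ L.alive e, w ℓ :=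
    sum_le_sum_of_subset_of_nonneg hPA fun ℓ _ _ => hw ℓ
  have h6 : ∑ ℓ ∈ L.alive e, w ℓ - ∑ ℓ ∈ L.consumed e, w ℓ ≤
      C * (∑ ℓ ∈ L.alive e, w ℓ - ∑ ℓ ∈ L.consumed e, w ℓ) :=
    le_mul_of_one_le_left (sub_nonneg.mpr h5) hC
  have hd1 : (1 : ℝ) ≤ d := by exact_mod_cast hd
  have h7 : ((L.consumed e).card : ℝ) ≤ d * ((L.consumed e).card : ℝ) :=
    le_mul_of_one_le_left (Nat.cast_nonneg _) hd1
  have hwp : w (L.product e) = L.size (L.product e) + 1 := rfl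
  have hCsum : C * ∑ ℓ ∈ L.consumed e, (L.size ℓ + 1) = C * ∑ ℓ ∈ L.consumed e, w ℓ := rfl
  linarith [h1, h2, h3, h4, h6, h7, hev, hwp, hCsum]

/-- `hstep`: the potential step at EVERY index (beyond the last event the potential is frozen and `f = v = 0`). [folklore] -/
theorem hstep (hW : L.WF) {a C : ℝ} (hC : 1 ≤ C) {d : ℕ} (hd : 1 ≤ d)
    (hfnd : ∀ e, e ≤ L.E → ∀ ℓ ∈ L.founded e, L.size ℓ + 1 ≤ a * L.fmass ℓ)
    (hev : ∀ e, e < L.E → L.size (L.product e) + 2 ≤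
      C * ∑ ℓ ∈ L.consumed e, (L.size ℓ + 1) + 2 * ((L.consumed e).card : ℝ) + a * L.gmass e) (i : ℕ) :
    L.Ψ (i + 1) ≤ C * L.Ψ i + (a * L.f (i + 1) + 2 * d * L.v (i + 1)) := by
  by_cases hi : i < L.E
  · exact Ψ_succ_le hW hC hd hi (hfnd (i + 1) hi) (hev i hi)
  · have hle : L.E ≤ i := Nat.not_lt.mp hi
    rw [L.Ψ_of_ge (Nat.le_succ_of_le hle), ← L.Ψ_of_ge hle, L.f_succ_of_le hle, L.v_succ_of_le hle]
    have hΨ := Ψ_nonneg hW i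
    nlinarith

/-- THE LINEAGE COUNT: up to epoch `n ≤ E`, the consumed parts plus the lineages still alive are at most the founded
lineages plus the events (each event removes `#consumed e` lineages and adds exactly one). [folklore] -/
theorem count_le (hW : L.WF) : ∀ n, n ≤ L.E →
    ∑ e ∈ range n, (L.consumed e).card + (L.alive n).card ≤ ∑ e ∈ range (n + 1), (L.founded e).card + n
  | 0, _ => by simp
  | n + 1, hn => by
    have ih := count_le hW n (Nat.le_of_succ_le hn)
    have hsub : L.consumed n ⊆ L.alive n := hW.consumed_sub n (Nat.lt_of_succ_le hn)
    have hcard : (L.alive (n + 1)).card + (L.consumed n).card ≤ (L.alive n).card + 1 + (L.founded (n + 1)).card := by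
      have h1 : (L.alive (n + 1)).card ≤
          (insert (L.product n) (L.alive n \ L.consumed n)).card + (L.founded (n + 1)).card := by
        rw [alive_succ]; exact card_union_le _ _
      have h2 : (insert (L.product n) (L.alive n \ L.consumed n)).card ≤ (L.alive n \ L.consumed n).card + 1 :=
        card_insert_le _ _
      have h3 : (L.alive n \ L.consumed n).card + (L.consumed n).card = (L.alive n).card :=
        card_sdiff_add_card_eq_card hsub
      omega
    rw [sum_range_succ, sum_range_succ]
    omega

/-- Every founded lineage books mass `≥ 1`, so the founders of epoch `i ≤ E` are at most `f i` in number. [folklore] -/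
theorem card_founded_le_f (hW : L.WF) {i : ℕ} (hi : i ≤ L.E) : ((L.founded i).card : ℝ) ≤ L.f i := by
  have hcard : ((L.founded i).card : ℝ) ≤ ∑ ℓ ∈ L.founded i, L.fmass ℓ := by
    have h := sum_le_sum (s := L.founded i) (f := fun _ => (1 : ℝ)) (g := L.fmass)
      fun ℓ hℓ => hW.one_le_fmass i ℓ hℓ
    simpa using h
  cases i with
  | zero => simpa using hcard
  | succ e =>
    rw [L.f_succ_of_lt (Nat.lt_of_succ_le hi)]
    have := hW.gmass_nonneg e
    linarith

/-- The founded lineages are at most the total booked birth mass in number. [folklore] -/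
theorem card_founded_le_Dtot (hW : L.WF) :
    ((∑ e ∈ range (L.E + 1), (L.founded e).card : ℕ) : ℝ) ≤ L.Dtot := by
  rw [Dtot, Nat.cast_sum]
  exact sum_le_sum fun i hi => card_founded_le_f hW (Nat.lt_succ_iff.mp (mem_range.mp hi))

/-- The SHARP vertex count: `Σ_{i ≤ m} v i + 1 ≤ Dtot + E` for `m ≥ E` (consumed parts + one lineage alive at
the end ≤ founded lineages + events, and founded lineages ≤ booked birth mass). [folklore] -/
theorem sum_v_add_one_le (hW : L.WF) {m : ℕ} (hm : L.E ≤ m) :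
    ∑ i ∈ range (m + 1), L.v i + 1 ≤ L.Dtot + L.E := by
  rw [L.sum_v_eq hm]
  have hc := count_le hW L.E le_rfl
  have hne : 1 ≤ (L.alive L.E).card := card_pos.mpr (alive_nonempty _ hW L.E)
  have hf := card_founded_le_Dtot hW
  have hc' : ((∑ e ∈ range L.E, (L.consumed e).card : ℕ) : ℝ) + 1 ≤
      ((∑ e ∈ range (L.E + 1), (L.founded e).card : ℕ) : ℝ) + L.E := by
    have : ∑ e ∈ range L.E, (L.consumed e).card + 1 ≤ ∑ e ∈ range (L.E + 1), (L.founded e).card + L.E := by omega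
    exact_mod_cast this
  linarith

/-- `hV`: the vertex count of the sub-history in the shape of `lifetime_lt`, `Σ_{i ≤ m} v i ≤ 2·m + D`, whenever the
events are paid for (`E ≤ m`) and the booked birth mass is bounded (`Dtot ≤ D`); slack `m + 1 + (D − Dtot)`. [folklore] -/
theorem hV (hW : L.WF) {m : ℕ} (hm : L.E ≤ m) {D : ℝ} (hD : L.Dtot ≤ D) :
    ∑ i ∈ range (m + 1), L.v i ≤ 2 * m + D := by
  have h := sum_v_add_one_le hW hm
  have hmE : (L.E : ℝ) ≤ m := by exact_mod_cast hm
  have hm0 : (0 : ℝ) ≤ m := Nat.cast_nonneg _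
  linarith

/-- `hσ`: the base lineage of epoch `i` is alive in epoch `i`, so `σ i ≤ Ψ i ≤ C·Ψ i` (`t = i`; beyond the last
event `σ = 0 ≤ C·Ψ 0`). [folklore] -/
theorem hσ (hW : L.WF) {C : ℝ} (hC : 1 ≤ C) (m : ℕ) :
    ∀ i, i ≤ m → ∃ t, t ≤ m ∧ L.σ i ≤ C * L.Ψ t := by
  intro i hi
  have key : ∀ t, L.Ψ t ≤ C * L.Ψ t := fun t => le_mul_of_one_le_left (Ψ_nonneg hW t) hC
  cases i with
  | zero =>
    refine ⟨0, hi, ?_⟩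
    have hmem : L.base₀ ∈ L.alive 0 := by simpa using hW.base₀_mem
    have h := size_le_Ψ hW (Nat.zero_le _) hmem
    rw [σ_zero]
    exact le_trans h (key 0)
  | succ e =>
    by_cases he : e < L.E
    · refine ⟨e + 1, hi, ?_⟩
      rw [L.σ_succ_of_lt he]
      exact le_trans (size_le_Ψ hW he (L.product_mem_alive e)) (key (e + 1))
    · refine ⟨0, Nat.zero_le _, ?_⟩
      rw [L.σ_succ_of_le (Nat.not_lt.mp he)]
      exact mul_nonneg (le_trans zero_le_one hC) (Ψ_nonneg hW 0)

/-- LEMMA Y's DATA BINDERS ON THE LEDGER, packaged in the literal order and shapes of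
`…T4BankAgeYoung.lifetime_lt` (`hf hv hΨ0 hfound hstep hD hV hσ`) with a general new-part constant `a`: from a
well-formed ledger, the two size inputs, `E ≤ m` and `Dtot ≤ D`. [folklore] -/
theorem lifetime_binders (hW : L.WF) {a C : ℝ} (hC : 1 ≤ C) {d : ℕ} (hd : 1 ≤ d)
    (hfnd : ∀ e, e ≤ L.E → ∀ ℓ ∈ L.founded e, L.size ℓ + 1 ≤ a * L.fmass ℓ)
    (hev : ∀ e, e < L.E → L.size (L.product e) + 2 ≤
      C * ∑ ℓ ∈ L.consumed e, (L.size ℓ + 1) + 2 * ((L.consumed e).card : ℝ) + a * L.gmass e)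
    {m : ℕ} (hm : L.E ≤ m) {D : ℝ} (hDD : L.Dtot ≤ D) :
    (∀ i, 0 ≤ L.f i) ∧ (∀ i, 0 ≤ L.v i) ∧ 0 ≤ L.Ψ 0 ∧ L.Ψ 0 ≤ a * L.f 0 ∧
    (∀ i, L.Ψ (i + 1) ≤ C * L.Ψ i + (a * L.f (i + 1) + 2 * d * L.v (i + 1))) ∧
    (∑ i ∈ Finset.range (m + 1), L.f i ≤ D) ∧ (∑ i ∈ Finset.range (m + 1), L.v i ≤ 2 * m + D) ∧
    (∀ i, i ≤ m → ∃ t, t ≤ m ∧ L.σ i ≤ C * L.Ψ t) :=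
  ⟨f_nonneg hW, L.v_nonneg, Ψ_nonneg hW 0, hfound (hfnd 0 (Nat.zero_le _)), hstep hW hC hd hfnd hev,
    L.hD hm hDD, hV hW hm hDD, hσ hW hC m⟩

/-- The instance `a = 2·14^d` — the literal shapes of `…T4BankAgeYoung.lifetime_lt`'s `hfound` / `hstep`. [folklore] -/
theorem lifetime_binders_two (hW : L.WF) {C : ℝ} (hC : 1 ≤ C) {d : ℕ} (hd : 1 ≤ d)
    (hfnd : ∀ e, e ≤ L.E → ∀ ℓ ∈ L.founded e, L.size ℓ + 1 ≤ 2 * 14 ^ d * L.fmass ℓ)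
    (hev : ∀ e, e < L.E → L.size (L.product e) + 2 ≤
      C * ∑ ℓ ∈ L.consumed e, (L.size ℓ + 1) + 2 * ((L.consumed e).card : ℝ) + 2 * 14 ^ d * L.gmass e)
    {m : ℕ} (hm : L.E ≤ m) {D : ℝ} (hDD : L.Dtot ≤ D) :
    (∀ i, 0 ≤ L.f i) ∧ (∀ i, 0 ≤ L.v i) ∧ 0 ≤ L.Ψ 0 ∧ L.Ψ 0 ≤ 2 * 14 ^ d * L.f 0 ∧
    (∀ i, L.Ψ (i + 1) ≤ C * L.Ψ i + (2 * 14 ^ d * L.f (i + 1) + 2 * d * L.v (i + 1))) ∧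
    (∑ i ∈ Finset.range (m + 1), L.f i ≤ D) ∧ (∑ i ∈ Finset.range (m + 1), L.v i ≤ 2 * m + D) ∧
    (∀ i, i ≤ m → ∃ t, t ≤ m ∧ L.σ i ≤ C * L.Ψ t) :=
  lifetime_binders hW hC hd hfnd hev hm hDD

/-- The instance `a = 4·14^d` — the literal shapes of `…T4BankAgeYoung.lifetime_lt_four` (v1.1 §9), matching the
model constant of `…T4Enlargement.hnew_collar_three`. [folklore] -/
theorem lifetime_binders_four (hW : L.WF) {C : ℝ} (hC : 1 ≤ C) {d : ℕ} (hd : 1 ≤ d)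
    (hfnd : ∀ e, e ≤ L.E → ∀ ℓ ∈ L.founded e, L.size ℓ + 1 ≤ 4 * 14 ^ d * L.fmass ℓ)
    (hev : ∀ e, e < L.E → L.size (L.product e) + 2 ≤
      C * ∑ ℓ ∈ L.consumed e, (L.size ℓ + 1) + 2 * ((L.consumed e).card : ℝ) + 4 * 14 ^ d * L.gmass e)
    {m : ℕ} (hm : L.E ≤ m) {D : ℝ} (hDD : L.Dtot ≤ D) :
    (∀ i, 0 ≤ L.f i) ∧ (∀ i, 0 ≤ L.v i) ∧ 0 ≤ L.Ψ 0 ∧ L.Ψ 0 ≤ 4 * 14 ^ d * L.f 0 ∧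
    (∀ i, L.Ψ (i + 1) ≤ C * L.Ψ i + (4 * 14 ^ d * L.f (i + 1) + 2 * d * L.v (i + 1))) ∧
    (∑ i ∈ Finset.range (m + 1), L.f i ≤ D) ∧ (∑ i ∈ Finset.range (m + 1), L.v i ≤ 2 * m + D) ∧
    (∀ i, i ≤ m → ∃ t, t ≤ m ∧ L.σ i ≤ C * L.Ψ t) :=
  lifetime_binders hW hC hd hfnd hev hm hDD

end Binders

/-! ## §5 Non-vacuity -/

/-- A two-founder / one-merger sub-history on `ℕ`: lineages `0`, `1` founded at creation (size `1`, mass `1` each),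
merged by the single event into lineage `2` of size `5` with no new parts. [folklore] -/
def twoMerge : Ledger ℕ where
  E := 1
  founded e := if e = 0 then {0, 1} else ∅
  consumed _ := {0, 1}
  product _ := 2
  base₀ := 0
  size ℓ := if ℓ = 2 then 5 else if ℓ ≤ 1 then 1 else 0
  fmass _ := 1
  gmass _ := 0

/-- NON-VACUITY: `twoMerge` is well-formed, has an event, satisfies both size inputs with `a = 2`, `C = 1`, and its
potential genuinely moves (`Ψ 0 = 4`, `Ψ 1 = 6`; the step bound reads `6 ≤ 1·4 + (2·0 + 2·1·2)`), so the hypotheses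
of `lifetime_binders` are jointly inhabited by a ledger on which the conclusions are not trivial. [folklore] -/
example : twoMerge.WF ∧ twoMerge.E = 1 ∧
    (∀ e, e ≤ twoMerge.E → ∀ ℓ ∈ twoMerge.founded e, twoMerge.size ℓ + 1 ≤ 2 * twoMerge.fmass ℓ) ∧
    (∀ e, e < twoMerge.E → twoMerge.size (twoMerge.product e) + 2 ≤
      1 * ∑ ℓ ∈ twoMerge.consumed e, (twoMerge.size ℓ + 1) + 2 * ((twoMerge.consumed e).card : ℝ)
        + 2 * twoMerge.gmass e) ∧
    twoMerge.Ψ 0 = 4 ∧ twoMerge.Ψ 1 = 6 := by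
  refine ⟨⟨by simp [twoMerge], ?_, ?_, ?_, ?_⟩, rfl, ?_, ?_, ?_, ?_⟩
  · intro e he
    have he0 : e = 0 := by simp [twoMerge] at he; omega
    subst he0
    simp [twoMerge]
  · intro ℓ; simp only [twoMerge]; split_ifs <;> norm_num
  · intro e ℓ _; simp [twoMerge]
  · intro e; simp [twoMerge]
  · intro e _ ℓ hℓ
    simp only [twoMerge] at hℓ ⊢
    split_ifs at hℓ with h
    · simp at hℓ
      rcases hℓ with rfl | rfl <;> norm_num
    · simp at hℓ
  · intro e he
    have he0 : e = 0 := by simp [twoMerge] at he; omega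
    subst he0
    simp [twoMerge]
    norm_num
  · simp [Ψ, twoMerge]
    norm_num
  · simp [Ψ, alive, twoMerge]
    norm_num

end Ledger

end Literature.MathematicalPhysics.QuantumFieldTheory.Balaban1983to89.T4Genealogy
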